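import Mathlib
import HarnessLib
import HarnessLib.Audit
import Summits.CriticalPhenomena.Statement
import Literature.Probability.Percolation.HalfSpacePinnedPairs
import Literature.Probability.Percolation.ConnectivityThetaSqProofs
import Summits.CriticalPhenomena.PercolationContinuityZ3.Theses.PercLowPointHalfSpace
import Summits.CriticalPhenomena.PercolationContinuityZ3.Theorems.PercLowPointHalfSpaceBoundaryTwoArmDecayKTailReduction

/-!
# Strategist sketch — split of crux `BoundaryTwoArmDecay` (stmt-CriticalPhenomena-0911)

The three children, typed exactly as they would be rendered in the route file
(fully qualified, same `open`s as the route file), and the certificate that the LANDED theorem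
`Theorems.BoundaryTwoArmDecay.stub_kTailReduction` (p140944, accepted) has type
`KissMultiplicityTail → SlabCrossoverBelowSixFifths → AnnulusBlockingSubpolynomial → BoundaryTwoArmDecay`
up to δ-unfolding (child 3 is stmt-CriticalPhenomena-4446 `PercNonProliferation.SubpolynomialBlocking` verbatim).
-/

namespace Summit.CriticalPhenomena.PercolationContinuityZ3.Theses.PercLowPointHalfSpace.StrategistSplit

open scoped BigOperators Topology Manifold Classical MeasureTheory ProbabilityTheory Matrix InnerProductSpace ComplexConjugate ContinuousMap
open Filter Set Function TopologicalSpace MeasureTheory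

/-- Child 1 (crux): KTail — subpolynomial partner-kiss multiplicity in probability. -/
def KissMultiplicityTail : Prop :=
  ∀ s : ℝ, 0 < s → ∀ᶠ n : ℕ in Filter.atTop, (n : ℝ) ^ (-s) * (Literature.Probability.Percolation.bondPercolation (Literature.Probability.LatticeModels.zdGraph 3) (Literature.Probability.Percolation.criticalProbI 3)).real {ω | (∃ y : Literature.Probability.LatticeModels.Site 3, (n : ℤ) ≤ y 0 ∧ ω ∈ Literature.Probability.Percolation.openConnIn (Literature.Probability.Percolation.halfSpace 3) 0 y) ∧ (∃ y : Literature.Probability.LatticeModels.Site 3, (n : ℤ) ≤ y 0 ∧ ω ∈ Literature.Probability.Percolation.openConnIn (Literature.Probability.Percolation.halfSpace 3) ((0 : Literature.Probability.LatticeModels.Site 3) + Pi.single 1 1) y) ∧ ω ∉ Literature.Probability.Percolation.openConnIn (Literature.Probability.Percolation.halfSpace 3) 0 ((0 : Literature.Probability.LatticeModels.Site 3) + Pi.single 1 1)} ≤ (Literature.Probability.Percolation.bondPercolation (Literature.Probability.LatticeModels.zdGraph 3) (Literature.Probability.Percolation.criticalProbI 3)).real ({ω | (∃ y : Literature.Probability.LatticeModels.Site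 3, (n : ℤ) ≤ y 0 ∧ ω ∈ Literature.Probability.Percolation.openConnIn (Literature.Probability.Percolation.halfSpace 3) 0 y) ∧ (∃ y : Literature.Probability.LatticeModels.Site 3, (n : ℤ) ≤ y 0 ∧ ω ∈ Literature.Probability.Percolation.openConnIn (Literature.Probability.Percolation.halfSpace 3) ((0 : Literature.Probability.LatticeModels.Site 3) + Pi.single 1 1) y) ∧ ω ∉ Literature.Probability.Percolation.openConnIn (Literature.Probability.Percolation.halfSpace 3) 0 ((0 : Literature.Probability.LatticeModels.Site 3) + Pi.single 1 1)} ∩ {ω | {q : Literature.Probability.LatticeModels.Site 3 × Literature.Probability.LatticeModels.Site 3 | q.1 0 = 0 ∧ q.2 0 = 0 ∧ (Literature.Probability.LatticeModels.zdGraph 3).Adj q.1 q.2 ∧ ω ∈ Literature.Probability.Percolation.openConnIn (Literature.Probability.Percolation.halfSpace 3) 0 q.1 ∧ ω ∉ Literature.Probability.Percolation.openConnIn (Literature.Probability.Percolation.halfSpace 3) 0 q.2 ∧ ∃ y : Literature.Probability.LatticeModels.Site 3, (n : ℤ) ≤ y 0 ∧ ω ∈ Literature.Probability.Percolation.openConnIn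 (Literature.Probability.Percolation.halfSpace 3) q.2 y}.ncard ≤ ⌈(n : ℝ) ^ s⌉₊})

/-- Child 2 (crux): polynomial slab crossover with exponent capped below 6/5 (stmt-6700 strengthened). -/
def SlabCrossoverBelowSixFifths : Prop :=
  ∃ A : ℝ, 1 ≤ A ∧ A < 6 / 5 ∧ ∃ C : ℝ, 0 < C ∧ ∀ k n : ℕ, 1 ≤ k → ∀ x : Literature.Probability.LatticeModels.Site 3, (Literature.Probability.Percolation.bondPercolation (Literature.Probability.LatticeModels.zdGraph 3) (Literature.Probability.Percolation.criticalProbI 3)).real {ω | ∃ y : Literature.Probability.LatticeModels.Site 3, (n : ℤ) ≤ max |y 1 - x 1| |y 2 - x 2| ∧ ω ∈ Literature.Probability.Percolation.openConnIn {z : Literature.Probability.LatticeModels.Site 3 | |z 0| ≤ (k : ℤ)} x y} ≤ C * (k : ℝ) ^ C * Real.exp (-((n : ℝ) / (C * (k : ℝ) ^ A)))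

/-- Child 3 (crux, = stmt-CriticalPhenomena-4446 verbatim): subpolynomial annulus blocking at p_c(ℤ³). -/
def AnnulusBlockingSubpolynomial : Prop :=
  ∀ s : ℝ, 0 < s → ∀ᶠ n : ℕ in Filter.atTop, (n : ℝ) ^ (-s) ≤ (Literature.Probability.Percolation.bondPercolation (Literature.Probability.LatticeModels.zdGraph 3) (Literature.Probability.Percolation.criticalProbI 3)).real {ω | ¬ ∃ x ∈ Literature.Probability.LatticeModels.box 3 n, ∃ y ∈ Literature.Probability.LatticeModels.innerBoundary (Literature.Probability.LatticeModels.zdGraph 3) (Literature.Probability.LatticeModels.box 3 (2 * n)), ω ∈ Literature.Probability.Percolation.openConnIn ↑(Literature.Probability.LatticeModels.box 3 (2 * n)) x y}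

/-- Split certificate: the landed reduction IS the glue `C₁ → C₂ → C₃ → BoundaryTwoArmDecay` (δ-unfolding only). -/
theorem BoundaryTwoArmDecay_of_subs :
    KissMultiplicityTail → SlabCrossoverBelowSixFifths → AnnulusBlockingSubpolynomial →
      Summit.CriticalPhenomena.PercolationContinuityZ3.Theses.PercLowPointHalfSpace.BoundaryTwoArmDecay :=
  Summit.CriticalPhenomena.PercolationContinuityZ3.Theorems.BoundaryTwoArmDecay.stub_kTailReduction

/-- Same, by `intro`/`exact` (in case the gate elaborates the glue applied to hypotheses). -/
example (h₁ : KissMultiplicityTail) (h₂ : SlabCrossoverBelowSixFifths) (h₃ : AnnulusBlockingSubpolynomial) :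
    Summit.CriticalPhenomena.PercolationContinuityZ3.Theses.PercLowPointHalfSpace.BoundaryTwoArmDecay :=
  Summit.CriticalPhenomena.PercolationContinuityZ3.Theorems.BoundaryTwoArmDecay.stub_kTailReduction h₁ h₂ h₃

/-- Child 3 is literally the sibling route's decl (stmt-4446). -/
example : AnnulusBlockingSubpolynomial ↔
    Summit.CriticalPhenomena.PercolationContinuityZ3.Theses.PercNonProliferation.SubpolynomialBlocking := Iff.rfl

end Summit.CriticalPhenomena.PercolationContinuityZ3.Theses.PercLowPointHalfSpace.StrategistSplit
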